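import Literature.AlgebraicGeometry.HodgeTheory.VHSDataDeterminationLocusNowhereDense
import HarnessLib

/-!
# When the Hodge locus of bounded norm is the WHOLE connected base, ONE multivalued flat integral class accounts for it: some determination of it
# is of type `(p, p)` at every point (a component of `S^{(K)}` dominating `S`); dichotomy «generic multivalued Hodge class, or nowhere dense»

Topic `Literature/AlgebraicGeometry/HodgeTheory` (namespace `Literature.AlgebraicGeometry.Motives.VHSData`), over
`HodgeTheory/VHSDataHodgeLocusNowhereDense.lean` (for each `K`, `hodgeLocusOfNormLe D p K` is `S` or nowhere dense; the chart is cut out by finitely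
many flat classes) and `HodgeTheory/VHSDataDeterminationLocusNowhereDense.lean` (Cor. 1.3 in analytic form: the locus of the determinations of ONE
class is closed, `S` or nowhere dense).  THEOREMS ONLY (no definition, no named fact, no instance; D-0026 net debt `0`).

PRINTED SOURCE, VERBATIM (E. Cattani, P. Deligne, A. Kaplan, *On the locus of Hodge classes*, J. Amer. Math. Soc. 8 (1995), p. 484).  «locally on
`S`, `S^{(K)}` is a finite disjoint sum of closed analytic subspaces.»  «**Corollary 1.3.** Let `u` be a section of the local system `𝒱_ℤ` on a
universal covering of `S`. The set of points in `S` where some determination of `u` is of type `(0, 0)` is an algebraic subvariety of `S`.  *Proof.*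
Such a set is a union of images of connected components of `S^{(K)}`, for `K = Q(u, u)`.»  Read on a connected base: the image of `S^{(K)}` is `S`
exactly when one of its finitely many local sheets is a whole chart, and that sheet, continued along paths (flatness of the charts), is a
multivalued flat class Hodge everywhere — its Cor. 1.3 locus is closed, contains an open set, hence is `S`.

WHAT IS PROVED, for `D : VHSData S k` (`k = p + p`) on a preconnected `S` covered by FLAT interior period charts modelled on a complex normed space
`E` (`ψ : OpenPartialHomeomorph S E` with preconnected target; `e c : V_{ψ⁻¹(c)} ≃ V` carrying `F^p` to `h(c)⁻¹F₀^p` (`h` weakly holomorphic), `Q`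
to `Q₀`, `V_ℤ` ONTO a finitely generated `Λ₀`; comparison `κ`; path classes inside the chart with `e_{c′}(δ·y) = e_c(y)`):
* §1 **`exists_determinationLocus_eq_univ_of_hodgeLocusOfNormLe_eq_univ`** — if `hodgeLocusOfNormLe D p K = S` (`S` nonempty), there are a point
  `s` and a NONZERO integral class `u₀ ∈ V_ℤ,s` with `Q(u₀, u₀) ≤ K` such that **at EVERY point of `S` some determination `γ · u₀` is of type
  `(p, p)`**.
* §2 **`exists_generic_or_isNowhereDense`** — the refined dichotomy: EITHER such a «generic multivalued Hodge class of norm `≤ K`» exists, OR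
  `hodgeLocusOfNormLe D p K` is NOWHERE DENSE.

## References

* [CattaniDeligneKaplan1995] E. Cattani, P. Deligne, A. Kaplan, *On the locus of Hodge classes*, J. Amer. Math. Soc. 8 (1995) 483–506: §1
  (pp. 483–484), Cor. 1.3.
* [VoisinHodgeII2003] C. Voisin, *Hodge Theory and Complex Algebraic Geometry II* (2003), §5.3.1 Lemma 5.13.
* [Schmid1973] W. Schmid, *Variation of Hodge structure: the singularities of the period mapping*, Invent. Math. 22 (1973), §2 (cite only).
-/

noncomputable section

open scoped TensorProduct ComplexOrder
open _root_.Topology _root_.Filter Set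

namespace Literature.AlgebraicGeometry

open Module
open Motives Motives.MixedHodgeStructure Motives.HodgeStructure
open Motives.HodgeStructure (conj ofRat ofRat_apply conj_ofRat)
open HodgeTheory

universe u

namespace Motives.VHSData

variable {S : Type} [TopologicalSpace S] {k : ℤ} (D : VHSData S k)
variable {V : Type u} [AddCommGroup V] [Module ℚ V] [FiniteDimensional ℚ V]
variable {E : Type*} [NormedAddCommGroup E] [NormedSpace ℂ E]

/-! ## §0 One chart: if the whole chart lies in the Hodge locus, one flat class is Hodge on the whole chart -/

/-- **If every point of a preconnected open flat chart lies in `hodgeLocusOfNormLe D p K`, then ONE of the finitely many flat classes is of type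
`(p, p)` on the WHOLE chart**, and it is the flat value of a nonzero integral class `u₀` at `ρ(c₀)` with `Q(u₀, u₀) ≤ K` all of whose in-chart
determinations are Hodge: for every `c ∈ U` some determination of `u₀` at `ρ(c)` is of type `(p, p)` (the finite union of closed loci equals the
open chart, so one locus has nonempty interior, hence is the chart). [cite: CattaniDeligneKaplan1995, §1 (p. 484), Cor. 1.3] [cite: VoisinHodgeII2003, §5.3.1 Lemma 5.13] -/
theorem exists_forall_determination_isHodgeAt_chart_of_forall_mem {p : ℤ} (hpk : p + p = k) (ρ : E → S) {U : Set E} (hUo : IsOpen U)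
    (hUc : IsPreconnected U) {c₀ : E} (hc₀ : c₀ ∈ U) (e : ∀ c : E, D.V.fiber (ρ c) ≃ₗ[ℚ] V) (H₀ : HodgeStructure V k) (P₀ : H₀.Polarization)
    (h : E → Module.End ℂ (ℂ ⊗[ℚ] V)) (hh : ∀ (φ : Module.Dual ℂ (ℂ ⊗[ℚ] V)) (w : ℂ ⊗[ℚ] V), AnalyticOnNhd ℂ (fun c => φ (h c w)) U)
    (hF : ∀ c ∈ U, ((D.hodge (ρ c)).F p).map ((e c).toLinearMap.baseChange ℂ) = (H₀.F p).comap (h c))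
    (hQ : ∀ c ∈ U, ∀ x y : D.V.fiber (ρ c), (D.form (ρ c)).form x y = P₀.form (e c x) (e c y))
    (Λ : Submodule ℤ V) (hΛ : Λ.FG) (hΛ₁ : ∀ c ∈ U, ∀ u : D.VZ.fiber (ρ c), e c (D.toRat (ρ c) u) ∈ Λ)
    (hΛ₂ : ∀ c ∈ U, ∀ v ∈ Λ, ∃ u : D.VZ.fiber (ρ c), e c (D.toRat (ρ c) u) = v)
    {κ : ℝ} (hκ : 0 < κ) (hnorm : ∀ c ∈ U, ∀ x : D.V.fiber (ρ c), κ * P₀.hodgeNorm (ofRat (e c x)) ≤ (D.form (ρ c)).hodgeNorm (ofRat x))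
    (hflat : ∀ c ∈ U, ∀ c' ∈ U, ∃ δ : Path.Homotopic.Quotient (ρ c) (ρ c'), ∀ y : D.V.fiber (ρ c), e c' (D.V.transport δ y) = e c y)
    (K : ℤ) (hall : ∀ c ∈ U, ρ c ∈ D.hodgeLocusOfNormLe p K) :
    ∃ u₀ : D.VZ.fiber (ρ c₀), u₀ ≠ 0 ∧ (D.form (ρ c₀)).form (D.toRat (ρ c₀) u₀) (D.toRat (ρ c₀) u₀) ≤ (K : ℚ) ∧
      ∀ c ∈ U, ∃ γ : Path.Homotopic.Quotient (ρ c₀) (ρ c), D.IsHodgeAt (ρ c) p (D.VZ.transport γ u₀) := by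
  obtain ⟨Υ, hΥ, hΥprop, hiff⟩ := D.exists_finite_hodgeLocusOfNormLe_param_chart_iff hpk ρ U e H₀ P₀ h hF hQ Λ hΛ hΛ₁ hΛ₂ hκ hnorm K
  -- the finite union of the loci is the whole (open, nonempty) chart, so one locus is the chart
  have hv : ∃ v ∈ Υ, ∀ c ∈ U, h c (ofRat v) ∈ H₀.F p := by
    rcases exists_forall_mem_or_interior_eq_empty_of_finite hUc h hh (H₀.F p) (hΥ.image ofRat) with ⟨w, ⟨v, hv, rfl⟩, hall'⟩ | hint
    · exact ⟨v, hv, hall'⟩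
    · exfalso
      have hsub : U ⊆ {c : E | c ∈ U ∧ ∃ w ∈ ofRat '' Υ, h c w ∈ H₀.F p} := fun c hc => by
        obtain ⟨v, hv, hvF⟩ := (hiff c hc).1 (hall c hc)
        exact ⟨hc, ofRat v, ⟨v, hv, rfl⟩, hvF⟩
      have hmem : c₀ ∈ interior {c : E | c ∈ U ∧ ∃ w ∈ ofRat '' Υ, h c w ∈ H₀.F p} := interior_maximal hsub hUo hc₀
      rw [hint] at hmem
      exact hmem
  obtain ⟨v, hvΥ, hvall⟩ := hv
  obtain ⟨hvΛ, hv0, hvK⟩ := hΥprop v hvΥ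
  obtain ⟨u₀, hu₀⟩ := hΛ₂ c₀ hc₀ v hvΛ
  have key : ∀ c ∈ U, ∀ u : D.VZ.fiber (ρ c), D.IsHodgeAt (ρ c) p u ↔ h c (ofRat (e c (D.toRat (ρ c) u))) ∈ H₀.F p :=
    fun c hc u => by rw [D.isHodgeAt_iff_ofRat_mem_of_map_F_eq (e c) (hF c hc) u, Submodule.mem_comap]
  refine ⟨u₀, fun h0 => hv0 ?_, ?_, fun c hc => ?_⟩
  · rw [← hu₀, h0, map_zero, map_zero]
  · rw [hQ c₀ hc₀, hu₀]
    exact hvK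
  · obtain ⟨δ, hδ⟩ := hflat c₀ hc₀ c hc
    refine ⟨δ, (key c hc _).2 ?_⟩
    rw [← D.transport_toRat, hδ, hu₀]
    exact hvall c hc

/-! ## §1 If the bounded Hodge locus is the whole base, one multivalued class accounts for it -/

/-- **IF `hodgeLocusOfNormLe D p K = S` ON A CONNECTED BASE, ONE MULTIVALUED FLAT CLASS IS HODGE EVERYWHERE.**  `D : VHSData S k` (`k = p + p`), `S`
preconnected and nonempty, covered by FLAT interior period charts (modelled on a complex normed space `E`; flat trivialization carrying `F^p` to
`h(c)⁻¹F₀^p` with `h` weakly holomorphic, `Q` to `Q₀`, `V_ℤ` ONTO a finitely generated lattice, comparison `κ`, in-chart path classes with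
`e_{c′}(δ·y) = e_c(y)`).  If every point of `S` carries a nonzero integral class of type `(p, p)` with `Q ≤ K`, then **there are `s ∈ S` and a
NONZERO `u₀ ∈ V_ℤ,s` with `Q(u₀, u₀) ≤ K` such that at EVERY `t ∈ S` some determination `γ · u₀` (`γ : s ⇝ t`) is of type `(p, p)`** («such a set is
a union of images of connected components of `S^{(K)}`»: a component dominating `S`). [cite: CattaniDeligneKaplan1995, §1 (p. 484), Cor. 1.3]
[cite: VoisinHodgeII2003, §5.3.1 Lemma 5.13] -/
theorem exists_determinationLocus_eq_univ_of_hodgeLocusOfNormLe_eq_univ [PreconnectedSpace S] [Nonempty S] {p : ℤ} (hpk : p + p = k) (K : ℤ)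
    (hint : ∀ x : S, ∃ ψ : OpenPartialHomeomorph S E, x ∈ ψ.source ∧ IsPreconnected ψ.target ∧
      ∃ (e : ∀ c : E, D.V.fiber (ψ.symm c) ≃ₗ[ℚ] V) (H₀ : HodgeStructure V k) (P₀ : H₀.Polarization) (h : E → Module.End ℂ (ℂ ⊗[ℚ] V))
        (Λ₀ : Submodule ℤ V) (κ : ℝ),
        (∀ (φ : Module.Dual ℂ (ℂ ⊗[ℚ] V)) (w : ℂ ⊗[ℚ] V), AnalyticOnNhd ℂ (fun c => φ (h c w)) ψ.target) ∧
        (∀ c ∈ ψ.target, ((D.hodge (ψ.symm c)).F p).map ((e c).toLinearMap.baseChange ℂ) = (H₀.F p).comap (h c)) ∧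
        (∀ c ∈ ψ.target, ∀ x y : D.V.fiber (ψ.symm c), (D.form (ψ.symm c)).form x y = P₀.form (e c x) (e c y)) ∧
        Λ₀.FG ∧ (∀ c ∈ ψ.target, ∀ u : D.VZ.fiber (ψ.symm c), e c (D.toRat (ψ.symm c) u) ∈ Λ₀) ∧
        (∀ c ∈ ψ.target, ∀ v ∈ Λ₀, ∃ u : D.VZ.fiber (ψ.symm c), e c (D.toRat (ψ.symm c) u) = v) ∧
        0 < κ ∧ (∀ c ∈ ψ.target, ∀ x : D.V.fiber (ψ.symm c), κ * P₀.hodgeNorm (ofRat (e c x)) ≤ (D.form (ψ.symm c)).hodgeNorm (ofRat x)) ∧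
        (∀ c ∈ ψ.target, ∀ c' ∈ ψ.target, ∃ δ : Path.Homotopic.Quotient (ψ.symm c) (ψ.symm c'),
          ∀ y : D.V.fiber (ψ.symm c), e c' (D.V.transport δ y) = e c y))
    (hZ : D.hodgeLocusOfNormLe p K = univ) :
    ∃ (s : S) (u₀ : D.VZ.fiber s), u₀ ≠ 0 ∧ (D.form s).form (D.toRat s u₀) (D.toRat s u₀) ≤ (K : ℚ) ∧
      {t : S | ∃ γ : Path.Homotopic.Quotient s t, D.IsHodgeAt t p (D.VZ.transport γ u₀)} = univ := by
  obtain ⟨x⟩ := ‹Nonempty S›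
  obtain ⟨ψ, hx, hconn, e, H₀, P₀, h, Λ₀, κ, hh, hF, hQ, hΛ₀, hΛ₁, hΛ₂, hκ, hnorm, hflat⟩ := hint x
  have hc₀ : ψ x ∈ ψ.target := ψ.map_source hx
  -- one flat class is Hodge on the whole chart at `x`
  obtain ⟨u₀, hu₀0, hu₀K, hdet⟩ := D.exists_forall_determination_isHodgeAt_chart_of_forall_mem hpk ψ.symm ψ.open_target hconn hc₀ e H₀ P₀ h hh
    hF hQ Λ₀ hΛ₀ hΛ₁ hΛ₂ hκ hnorm hflat K fun c _ => by rw [hZ]; exact mem_univ _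
  refine ⟨ψ.symm (ψ x), u₀, hu₀0, hu₀K, ?_⟩
  -- its Cor. 1.3 locus is closed, `S` or nowhere dense, and contains the open chart domain
  set Z : Set S := {t : S | ∃ γ : Path.Homotopic.Quotient (ψ.symm (ψ x)) t, D.IsHodgeAt t p (D.VZ.transport γ u₀)} with hZdef
  have hsrc : ψ.source ⊆ Z := fun y hy => by
    have h1 := hdet (ψ y) (ψ.map_source hy)
    rwa [ψ.left_inv hy] at h1
  have hdich := D.determinationLocus_eq_univ_or_isNowhereDense hpk u₀ (E := E) fun y => by
    obtain ⟨ψ', hy, hconn', e', H₀', P₀', h', Λ', κ', hh', hF', -, hΛ', hΛ₁', -, hκ', hnorm', hflat'⟩ := hint y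
    exact ⟨ψ', hy, hconn', e', H₀', P₀', h', Λ', κ', hh', hF', hΛ', hΛ₁', hκ', hnorm', hflat'⟩
  rcases hdich.2 with huniv | hnd
  · exact huniv
  · exfalso
    -- a nowhere dense set cannot contain the nonempty open `ψ.source`
    have hint : ψ.source ⊆ interior (closure Z) := interior_maximal (hsrc.trans subset_closure) ψ.open_source
    have hx' : x ∈ interior (closure Z) := hint hx
    rw [hnd] at hx'
    exact hx'

/-! ## §2 The refined dichotomy: a generic multivalued Hodge class, or nowhere dense -/

/-- **A GENERIC MULTIVALUED HODGE CLASS OF NORM `≤ K`, OR THE BOUNDED HODGE LOCUS IS NOWHERE DENSE.**  Under the flat-chart hypotheses of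
`exists_determinationLocus_eq_univ_of_hodgeLocusOfNormLe_eq_univ` (`S` preconnected): EITHER there are `s ∈ S` and a nonzero `u₀ ∈ V_ℤ,s` with
`Q(u₀, u₀) ≤ K` some determination of which is of type `(p, p)` at EVERY point of `S`, OR `hodgeLocusOfNormLe D p K` is nowhere dense.
[cite: CattaniDeligneKaplan1995, §1 (p. 484), Cor. 1.3] [cite: VoisinHodgeII2003, §5.3.1 Lemma 5.13] -/
theorem exists_generic_or_isNowhereDense [PreconnectedSpace S] {p : ℤ} (hpk : p + p = k) (K : ℤ)
    (hint : ∀ x : S, ∃ ψ : OpenPartialHomeomorph S E, x ∈ ψ.source ∧ IsPreconnected ψ.target ∧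
      ∃ (e : ∀ c : E, D.V.fiber (ψ.symm c) ≃ₗ[ℚ] V) (H₀ : HodgeStructure V k) (P₀ : H₀.Polarization) (h : E → Module.End ℂ (ℂ ⊗[ℚ] V))
        (Λ₀ : Submodule ℤ V) (κ : ℝ),
        (∀ (φ : Module.Dual ℂ (ℂ ⊗[ℚ] V)) (w : ℂ ⊗[ℚ] V), AnalyticOnNhd ℂ (fun c => φ (h c w)) ψ.target) ∧
        (∀ c ∈ ψ.target, ((D.hodge (ψ.symm c)).F p).map ((e c).toLinearMap.baseChange ℂ) = (H₀.F p).comap (h c)) ∧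
        (∀ c ∈ ψ.target, ∀ x y : D.V.fiber (ψ.symm c), (D.form (ψ.symm c)).form x y = P₀.form (e c x) (e c y)) ∧
        Λ₀.FG ∧ (∀ c ∈ ψ.target, ∀ u : D.VZ.fiber (ψ.symm c), e c (D.toRat (ψ.symm c) u) ∈ Λ₀) ∧
        (∀ c ∈ ψ.target, ∀ v ∈ Λ₀, ∃ u : D.VZ.fiber (ψ.symm c), e c (D.toRat (ψ.symm c) u) = v) ∧
        0 < κ ∧ (∀ c ∈ ψ.target, ∀ x : D.V.fiber (ψ.symm c), κ * P₀.hodgeNorm (ofRat (e c x)) ≤ (D.form (ψ.symm c)).hodgeNorm (ofRat x)) ∧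
        (∀ c ∈ ψ.target, ∀ c' ∈ ψ.target, ∃ δ : Path.Homotopic.Quotient (ψ.symm c) (ψ.symm c'),
          ∀ y : D.V.fiber (ψ.symm c), e c' (D.V.transport δ y) = e c y)) :
    (∃ (s : S) (u₀ : D.VZ.fiber s), u₀ ≠ 0 ∧ (D.form s).form (D.toRat s u₀) (D.toRat s u₀) ≤ (K : ℚ) ∧
        ∀ t : S, ∃ γ : Path.Homotopic.Quotient s t, D.IsHodgeAt t p (D.VZ.transport γ u₀)) ∨
      IsNowhereDense (D.hodgeLocusOfNormLe p K) := by
  have hdich := D.hodgeLocusOfNormLe_eq_univ_or_isNowhereDense hpk K (E := E) fun y => by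
    obtain ⟨ψ', hy, hconn', e', H₀', P₀', h', Λ', κ', hh', hF', hQ', hΛ', hΛ₁', hΛ₂', hκ', hnorm', -⟩ := hint y
    exact ⟨ψ', hy, hconn', e', H₀', P₀', h', Λ', κ', hh', hF', hQ', hΛ', hΛ₁', hΛ₂', hκ', hnorm'⟩
  rcases hdich.2 with huniv | hnd
  · rcases isEmpty_or_nonempty S with hS | hS
    · exact Or.inr (by rw [Set.eq_empty_of_isEmpty (D.hodgeLocusOfNormLe p K)]; exact isNowhereDense_empty)
    · obtain ⟨s, u₀, hu₀0, hu₀K, hZ⟩ := D.exists_determinationLocus_eq_univ_of_hodgeLocusOfNormLe_eq_univ hpk K hint huniv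
      refine Or.inl ⟨s, u₀, hu₀0, hu₀K, fun t => ?_⟩
      have ht : t ∈ {t : S | ∃ γ : Path.Homotopic.Quotient s t, D.IsHodgeAt t p (D.VZ.transport γ u₀)} := by rw [hZ]; exact mem_univ t
      exact ht
  · exact Or.inr hnd

end Motives.VHSData

end Literature.AlgebraicGeometry

end
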